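import Literature.NumberTheory.DiophantineGeometry.GenEllFullGalois
import HarnessLib

/-!
# [GenEll] Thm 3.8, proof: over `L′ ⊇ L(E[n])` the `n`-torsion is Galois-fixed — transport to the
# algebraic closure of `L′`

S. Mochizuki, *Arithmetic elliptic curves in general position*, Math. J. Okayama Univ. **52** (2010)
[cite: MochizukiGenEll2010], proof of Theorem 3.8, p. 20:

> […] there exists a Galois extension `L′` of `L` of degree that divides `d₀ := (3²−1)(3²−3)(5²−1)(5²−5)
> = 23040`, so as to render the `3`- and `5`-torsion points of `E_L` rational over `L′` […], we may
> assume that `E_{L′} := E_L ×_L L′` has semi-stable reduction at all of the finite primes […]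

In the tree's model the curve `E_{L′}` is the presentation `(L′, W ⊗_L L′)` whose geometric points live
over `AlgebraicClosure L′`, a DIFFERENT algebraic closure from the one over `L` in which `L′ ⊆ L̄` was
cut out (as the fixed field of `ker ρ̄_{E,n}`, or any intermediate field fixed by it).  PROVED here, by
transport along an `L′`-isomorphism `ι : L̄ ≃ L̄′` of algebraic closures (Mathlib `IsAlgClosure.equiv`):

* `EllPoint.forall_smul_geomTorsion_map_eq_of_fixingSubgroup_le` — if `Gal(L̄/L′) ≤ ker ρ̄_{E,n}`
  (i.e. `L′ ⊇ L(E[n])`), then `Gal(L̄′/L′)` fixes every point of `(W ⊗_L L′)[n](L̄′)` — the hypothesis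
  "`E[n]` rational over `L′`" in the form consumed by the tree's semistability criterion
  `WeierstrassCurve.isSemistable_of_forall_smul_geomTorsion_eq_of_ne` ([IUTchIV] Prop. 1.8 (v),
  seat abc-iut-S5) for the base-changed curve.

Proof-only; no definitions.
-/

noncomputable section

open scoped Classical
open WeierstrassCurve

namespace Literature.NumberTheory.DiophantineGeometry.GenEll

namespace EllPoint

set_option maxHeartbeats 400000 in
/-- **`E[n]` is rational over any `L′ ⊆ L̄` fixed by `ker ρ̄_{E,n}`, in the algebraic closure of `L′`**:
for an intermediate field `L′` of `L̄/L` (a number field) with `Gal(L̄/L′) ≤ ker ρ̄_{E,n}`, every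
element of `Gal(L̄′/L′)` fixes every `n`-torsion point of `W ⊗_L L′` over `L̄′ = AlgebraicClosure L′`.
(Transport along an `L′`-isomorphism `L̄ ≃ L̄′`: `σ′ ↦ ι⁻¹σ′ι` lands in `Gal(L̄/L′) ≤ ker ρ̄_{E,n}`.)
[cite: MochizukiGenEll2010, Thm 3.8 p.20] -/
theorem forall_smul_geomTorsion_map_eq_of_fixingSubgroup_le (P : EllPoint)
    (L' : IntermediateField P.F (AlgebraicClosure P.F)) [NumberField L'] (n : ℕ)
    (hL : L'.fixingSubgroup ≤ (P.W.galoisRepTorsion (n : ℤ)).ker) :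
    ∀ (σ' : Field.absoluteGaloisGroup L')
      (Q : (P.W.map (algebraMap P.F L')).geomTorsion (n : ℤ)), σ' • Q = Q := by
  -- the two algebraic closures, an `L′`-isomorphism between them, and its `L`-linear shadow
  let K := AlgebraicClosure P.F
  let K' := AlgebraicClosure L'
  haveI : Algebra.IsAlgebraic L' K := Algebra.IsAlgebraic.tower_top (K := P.F) L'
  haveI : IsAlgClosure L' K :=
    { isAlgClosed := inferInstanceAs (IsAlgClosed (AlgebraicClosure P.F))
      isAlgebraic := inferInstance }
  let ι : K ≃ₐ[L'] K' := IsAlgClosure.equiv L' K K'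
  let ιF : K ≃ₐ[P.F] K' := ι.restrictScalars P.F
  let W' : WeierstrassCurve L' := P.W.map (algebraMap P.F L')
  -- transport of geometric points along `ι` and `ι⁻¹`
  let T : P.W.geomPoints →+ W'.geomPoints :=
    Affine.Point.map (W' := P.W) (ιF : K →ₐ[P.F] K')
  let Ti : W'.geomPoints →+ P.W.geomPoints :=
    Affine.Point.map (W' := P.W) (ιF.symm : K' →ₐ[P.F] K)
  have hmap_id : ∀ x : P.W.geomPoints, Affine.Point.map (W' := P.W) (AlgHom.id P.F K) x = x :=
    fun x => by cases x <;> rfl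
  have hmap_id' : ∀ y : W'.geomPoints, Affine.Point.map (W' := P.W) (AlgHom.id P.F K') y = y :=
    fun y => by cases y <;> rfl
  have hTiT : ∀ x, Ti (T x) = x := fun x => by
    change Affine.Point.map (W' := P.W) (ιF.symm : K' →ₐ[P.F] K)
      (Affine.Point.map (W' := P.W) (ιF : K →ₐ[P.F] K') x) = x
    rw [Affine.Point.map_map, AlgEquiv.symm_comp, hmap_id]
  have hTTi : ∀ y, T (Ti y) = y := fun y => by
    change Affine.Point.map (W' := P.W) (ιF : K →ₐ[P.F] K')
      (Affine.Point.map (W' := P.W) (ιF.symm : K' →ₐ[P.F] K) y) = y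
    rw [Affine.Point.map_map, AlgEquiv.comp_symm, hmap_id']
  -- the torsion point `Q′` comes from a torsion point `Q` over `L̄`
  intro σ' Q'
  have hQmem : Ti (Q' : W'.geomPoints) ∈ P.W.geomTorsion (n : ℤ) := by
    have hy := (Submodule.mem_torsionBy_iff (n : ℤ) (Q' : W'.geomPoints)).mp Q'.2
    refine (Submodule.mem_torsionBy_iff (n : ℤ) _).mpr ?_
    change (n : ℤ) • Ti (Q' : W'.geomPoints) = 0
    rw [← map_zsmul, show (n : ℤ) • (Q' : W'.geomPoints) = 0 from hy, map_zero]
  set Q : P.W.geomTorsion (n : ℤ) := ⟨Ti (Q' : W'.geomPoints), hQmem⟩ with hQ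
  have hTQ : T (Q : P.W.geomPoints) = (Q' : W'.geomPoints) := hTTi _
  -- pull `σ′` back along `ι`: an `L′`-linear automorphism of `L̄`, hence in `Gal(L̄/L′) ≤ ker ρ̄`
  let τ : K' ≃ₐ[L'] K' := (show K' ≃ₐ[L'] K' from σ')
  let σe : K ≃ₐ[L'] K := ι.trans (τ.trans ι.symm)
  let σ : Field.absoluteGaloisGroup P.F := σe.restrictScalars P.F
  have hσfix : σ ∈ L'.fixingSubgroup := by
    change (σe.restrictScalars P.F : K ≃ₐ[P.F] K) ∈ L'.fixingSubgroup
    rw [IntermediateField.mem_fixingSubgroup_iff]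
    intro x hx
    exact σe.commutes ⟨x, hx⟩
  have hker : P.W.galoisRepTorsion (n : ℤ) σ = 1 := hL hσfix
  have hσQ : σ • Q = Q := by
    have h := galoisRepTorsion_apply P.W (n : ℤ) σ Q
    rw [hker] at h
    exact h.symm
  -- the action of `σ′` on `T Q` is the transport of the action of `σ` on `Q`
  have hactP' : ∀ (y : W'.geomPoints), σ' • y =
      Affine.Point.map (W' := P.W) ((τ.restrictScalars P.F : K' ≃ₐ[P.F] K') : K' →ₐ[P.F] K') y :=
    fun y => by cases y <;> rfl
  have hcomp : (ιF : K →ₐ[P.F] K').comp ((σe.restrictScalars P.F : K ≃ₐ[P.F] K) : K →ₐ[P.F] K) =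
      ((τ.restrictScalars P.F : K' ≃ₐ[P.F] K') : K' →ₐ[P.F] K').comp (ιF : K →ₐ[P.F] K') := by
    ext z
    change ι (ι.symm (τ (ι z))) = τ (ι z)
    rw [AlgEquiv.apply_symm_apply]
  have key : T ((σ • Q : P.W.geomTorsion (n : ℤ)) : P.W.geomPoints) = σ' • T (Q : P.W.geomPoints) := by
    rw [hactP']
    change Affine.Point.map (W' := P.W) (ιF : K →ₐ[P.F] K')
        (Affine.Point.map (W' := P.W) ((σe.restrictScalars P.F : K ≃ₐ[P.F] K) : K →ₐ[P.F] K)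
          (Q : P.W.geomPoints)) =
      Affine.Point.map (W' := P.W) ((τ.restrictScalars P.F : K' ≃ₐ[P.F] K') : K' →ₐ[P.F] K')
        (Affine.Point.map (W' := P.W) (ιF : K →ₐ[P.F] K') (Q : P.W.geomPoints))
    rw [Affine.Point.map_map, Affine.Point.map_map, hcomp]
  -- conclude
  apply Subtype.ext
  rw [Literature.NumberTheory.EllipticCurves.AddSubgroup.torsionBy.coe_smul, ← hTQ, ← key, hσQ]

end EllPoint

end Literature.NumberTheory.DiophantineGeometry.GenEll

end
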